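import Mathlib
import Summits.NavierStokesRegularity.NavierStokesRegularity.Theorems.L3TimeExponentPincerRingPersistenceSlice
import Summits.NavierStokesRegularity.NavierStokesRegularity.Theorems.L3TimeExponentPincerRingPersistenceApriori
import HarnessLib.Audit
import HarnessLib

/-!
# L3TimeExponentPincer — ring persistence: the absolute impulse `∫ r²|η(t)|` stays `≤ 4P` (sup bootstrap)

Support kernel for the crux `L3CascadeJaw` (item stmt-NavierStokesRegularity-19499), DYNAMIC CORE of
the PERSISTENCE LEMMA `LpPersistence 3 (1/2) 2` (nsreg-p2 ROUND-11/12). Along a Tao-class solution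
(`0 < ν`) from an axisymmetric swirl-free datum with `η₀ = ω_θ/r ∈ L¹`, `|η₀| ≤ M`, `∫|η₀| ≤ m`,
`∫ η₀⁻ ≤ m⁻`, `∫ r²η₀^± ≤ P`: if `2τK ≤ √(√(2P))/2`, `K = 6√(M√m)√(m⁻)`, then `∫⁻ r²(Ω t)⁺ + ∫⁻ r²(Ω t)⁻
≤ 4P` on `[0, τ]` (`absImpulse_le`; weighted co-signed flux for both signs + Lamb identity + slice
bound `transport_pairing_le` + the scalar bootstrap run on `S = sup_{[0,τ]} ∫ r²|Ω|`, which is finite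
a priori by `abs_transport_le_apriori`). For a ring plus a dilute counter-shell the window is `≍ Re`
turnovers. WHAT THIS IS NOT: not a statement about blow-up — an a-priori bound for smooth flows.
-/


namespace Summit.NavierStokesRegularity.NavierStokesRegularity.Theorems.L3TimeExponentPincerRingPersistenceImpulse

open MeasureTheory Set Real Literature.Analysis.FluidPDE
open Summit.NavierStokesRegularity.NavierStokesRegularity.Theorems.L3TimeExponentPincerRingPersistenceDynamics
open Summit.NavierStokesRegularity.NavierStokesRegularity.Theorems.L3TimeExponentPincerRingPersistenceSlice
open Summit.NavierStokesRegularity.NavierStokesRegularity.Theorems.L3TimeExponentPincerRingPersistenceApriori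
open scoped ENNReal NNReal

section Impulse

variable {T ν : ℝ} {u₀ : EuclideanSpace ℝ (Fin 3) → EuclideanSpace ℝ (Fin 3)}
  {u : ℝ → EuclideanSpace ℝ (Fin 3) → EuclideanSpace ℝ (Fin 3)}
  {p : ℝ → EuclideanSpace ℝ (Fin 3) → ℝ}

/-- **The absolute impulse stays bounded**: Tao-class solution (`0 < ν`, `0 < T`), axisymmetric
swirl-free datum with `η₀ ∈ L¹`, `|η₀| ≤ M`, `∫|η₀| ≤ m`, `∫⁻ η₀⁻ ≤ m⁻`, `∫⁻ r²η₀^± ≤ P` (`0 < P`),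
`τ ∈ (0, T]` with `2τ · 6√(M√m)√(m⁻) ≤ √(√(2P))/2`; then `∫⁻ r²(Ω(t))⁺ + ∫⁻ r²(Ω(t))⁻ ≤ 4P` on `[0, τ]`. -/
theorem absImpulse_le (h : IsTaoSolutionOn T ν u₀ u p) (hT : 0 < T) (hν : 0 < ν)
    (h0 : IsAxisymmetric u₀) (h0' : HasNoSwirl u₀) (hL1 : Integrable (angVortQuot u₀))
    {M m mneg P : ℝ} (hM : ∀ x, |angVortQuot u₀ x| ≤ M) (hm : ∫ x, |angVortQuot u₀ x| ≤ m)
    (hmneg : ∫⁻ x, ENNReal.ofReal ((angVortQuot u₀ x)⁻) ≤ ENNReal.ofReal mneg) (hmneg0 : 0 ≤ mneg)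
    (hP : 0 < P)
    (hPp : ∫⁻ x, ENNReal.ofReal (cylRadius x ^ 2 * (angVortQuot u₀ x)⁺) ≤ ENNReal.ofReal P)
    (hPn : ∫⁻ x, ENNReal.ofReal (cylRadius x ^ 2 * (angVortQuot u₀ x)⁻) ≤ ENNReal.ofReal P)
    {τ : ℝ} (hτ : τ ∈ Ioc 0 T)
    (hsmall : 2 * τ * (6 * Real.sqrt (M * Real.sqrt m) * Real.sqrt mneg) ≤
      Real.sqrt (Real.sqrt (2 * P)) / 2)
    {t : ℝ} (ht : t ∈ Icc 0 τ) :
    (∫⁻ x, ENNReal.ofReal (cylRadius x ^ 2 * (angVortQuot (u t) x)⁺)) +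
      ∫⁻ x, ENNReal.ofReal (cylRadius x ^ 2 * (angVortQuot (u t) x)⁻) ≤ ENNReal.ofReal (4 * P) := by
  have hax : ∀ s ∈ Icc 0 T, IsAxisymmetric (u s) := h.isAxisymmetric hν hT h0
  have hsw : ∀ s ∈ Icc 0 T, HasNoSwirl (u s) := h.hasNoSwirl hν hT h0 h0'
  have h0T : (0 : ℝ) ∈ Icc 0 T := ⟨le_rfl, hT.le⟩
  have hτT : ∀ {s}, s ∈ Icc 0 τ → s ∈ Icc 0 T := fun hs => ⟨hs.1, hs.2.trans hτ.2⟩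
  have hM0 : 0 ≤ M := (abs_nonneg _).trans (hM 0)
  have hm0 : 0 ≤ m := (integral_nonneg fun x => abs_nonneg _).trans hm
  set K : ℝ := 6 * Real.sqrt (M * Real.sqrt m) * Real.sqrt mneg with hKdef
  have hK0 : 0 ≤ K := by positivity
  -- notation: the transport pairing and the two moments
  set F : ℝ → ℝ := fun s => ∫ x, (angVortQuot (u s) x)⁻ * (2 * (x 0 * u s x 0 + x 1 * u s x 1))
    with hFdef
  set Fp : ℝ → ℝ := fun s => ∫ x, (angVortQuot (u s) x)⁺ * (2 * (x 0 * u s x 0 + x 1 * u s x 1))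
    with hFpdef
  set Yp : ℝ → ℝ≥0∞ := fun s => ∫⁻ x, ENNReal.ofReal (cylRadius x ^ 2 * (angVortQuot (u s) x)⁺)
    with hYpdef
  set Yn : ℝ → ℝ≥0∞ := fun s => ∫⁻ x, ENNReal.ofReal (cylRadius x ^ 2 * (angVortQuot (u s) x)⁻)
    with hYndef
  -- (1) the weighted co-signed flux at every `s ∈ (0, T]`
  have hfluxn : ∀ s ∈ Ioc 0 T, Yn s ≤ ENNReal.ofReal P + ENNReal.ofReal (∫ r in Ioo 0 s, F r) := by
    intro s hs
    refine (h.lintegral_rsq_negPart_angVortQuot_le hT hν h0 h0' hL1 hs).trans ?_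
    exact add_le_add hPn le_rfl
  have hfluxp : ∀ s ∈ Ioc 0 T, Yp s ≤ ENNReal.ofReal P + ENNReal.ofReal (∫ r in Ioo 0 s, Fp r) := by
    intro s hs
    refine (h.lintegral_rsq_posPart_angVortQuot_le hT hν h0 h0' hL1 hs).trans ?_
    exact add_le_add hPp le_rfl
  have hfinn : ∀ s ∈ Icc 0 T, Yn s < ⊤ := by
    intro s hs
    rcases hs.1.eq_or_lt with h0s | h0s
    · rw [← h0s, hYndef]; simp only; rw [h.initial]; exact hPn.trans_lt ENNReal.ofReal_lt_top
    · exact (hfluxn s ⟨h0s, hs.2⟩).trans_lt (ENNReal.add_lt_top.2 ⟨ENNReal.ofReal_lt_top,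
        ENNReal.ofReal_lt_top⟩)
  have hfinp : ∀ s ∈ Icc 0 T, Yp s < ⊤ := by
    intro s hs
    rcases hs.1.eq_or_lt with h0s | h0s
    · rw [← h0s, hYpdef]; simp only; rw [h.initial]; exact hPp.trans_lt ENNReal.ofReal_lt_top
    · exact (hfluxp s ⟨h0s, hs.2⟩).trans_lt (ENNReal.add_lt_top.2 ⟨ENNReal.ofReal_lt_top,
        ENNReal.ofReal_lt_top⟩)
  -- (2) Lamb: `Fp = F` on `[0, T]`
  obtain ⟨B, hB0, hB⟩ := h.exists_bound_velocity
  have hFeq : ∀ s ∈ Icc 0 T, Fp s = F s := by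
    intro s hs
    obtain ⟨-, hp', hn', hrp, hrn, -, -, hr1n⟩ :=
      integrable_rsq_parts h hT hν h0 h0' hL1 hs (hfinp s hs) (hfinn s hs)
    have hcont : Continuous fun x : EuclideanSpace ℝ (Fin 3) => 2 * (x 0 * u s x 0 + x 1 * u s x 1) := by
      have hc : Continuous (u s) := (h.classical.contDiff_velocity hs).continuous
      have c0 : ∀ i : Fin 3, Continuous fun x : EuclideanSpace ℝ (Fin 3) => u s x i := fun i =>
        (PiLp.continuous_apply 2 _ i).comp hc
      have cx : ∀ i : Fin 3, Continuous fun x : EuclideanSpace ℝ (Fin 3) => x i := fun i =>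
        PiLp.continuous_apply 2 _ i
      exact continuous_const.mul (((cx 0).mul (c0 0)).add ((cx 1).mul (c0 1)))
    have hr1p : Integrable (fun x => cylRadius x * (angVortQuot (u s) x)⁺) := by
      have hpc : Continuous fun x => (angVortQuot (u s) x)⁺ := by
        have hΩc : Continuous (angVortQuot (u s)) :=
          (contDiff_angVortQuot (n := 0) (by
            exact_mod_cast (h.classical.contDiff_velocity hs).of_le (by norm_cast))).continuous
        have e : (fun x => (angVortQuot (u s) x)⁺) = fun x => max (angVortQuot (u s) x) 0 :=
          funext fun x => by rw [posPart_def]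
        rw [e]; exact hΩc.max continuous_const
      refine ((hp'.add hrp).div_const 2).mono' ((continuous_cylRadius.mul hpc).aestronglyMeasurable)
        (ae_of_all _ fun x => ?_)
      rw [Real.norm_eq_abs, abs_of_nonneg (mul_nonneg (cylRadius_nonneg x) (posPart_nonneg _))]
      show cylRadius x * (angVortQuot (u s) x)⁺ ≤
        ((angVortQuot (u s) x)⁺ + cylRadius x ^ 2 * (angVortQuot (u s) x)⁺) / 2
      nlinarith [mul_nonneg (sq_nonneg (cylRadius x - 1)) (posPart_nonneg (angVortQuot (u s) x))]
    have hbd : ∀ x : EuclideanSpace ℝ (Fin 3), |2 * (x 0 * u s x 0 + x 1 * u s x 1)| ≤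
        2 * B * cylRadius x := fun x => by
      rw [abs_mul, abs_two]
      calc 2 * |x 0 * u s x 0 + x 1 * u s x 1| ≤ 2 * (cylRadius x * ‖u s x‖) :=
            mul_le_mul_of_nonneg_left (abs_horizontal_inner_le x (u s x)) zero_le_two
        _ ≤ 2 * (cylRadius x * B) :=
            mul_le_mul_of_nonneg_left (mul_le_mul_of_nonneg_left (hB s hs x) (cylRadius_nonneg x))
              zero_le_two
        _ = 2 * B * cylRadius x := by ring
    have iP : Integrable fun x => (angVortQuot (u s) x)⁺ * (2 * (x 0 * u s x 0 + x 1 * u s x 1)) := by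
      refine ((hr1p.const_mul (2 * B))).mono' (hp'.1.mul hcont.aestronglyMeasurable)
        (ae_of_all _ fun x => ?_)
      rw [Real.norm_eq_abs, abs_mul, abs_of_nonneg (posPart_nonneg _)]
      calc (angVortQuot (u s) x)⁺ * |2 * (x 0 * u s x 0 + x 1 * u s x 1)|
          ≤ (angVortQuot (u s) x)⁺ * (2 * B * cylRadius x) :=
            mul_le_mul_of_nonneg_left (hbd x) (posPart_nonneg _)
        _ = 2 * B * (cylRadius x * (angVortQuot (u s) x)⁺) := by ring
    have iN : Integrable fun x => (angVortQuot (u s) x)⁻ * (2 * (x 0 * u s x 0 + x 1 * u s x 1)) := by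
      refine ((hr1n.const_mul (2 * B))).mono' (hn'.1.mul hcont.aestronglyMeasurable)
        (ae_of_all _ fun x => ?_)
      rw [Real.norm_eq_abs, abs_mul, abs_of_nonneg (negPart_nonneg _)]
      calc (angVortQuot (u s) x)⁻ * |2 * (x 0 * u s x 0 + x 1 * u s x 1)|
          ≤ (angVortQuot (u s) x)⁻ * (2 * B * cylRadius x) :=
            mul_le_mul_of_nonneg_left (hbd x) (negPart_nonneg _)
        _ = 2 * B * (cylRadius x * (angVortQuot (u s) x)⁻) := by ring
    exact integral_posPart_mul_horizontal_eq h hT hν h0 h0' hs iP iN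
  -- (3) a priori bound of `|F|` and finiteness of the sup
  obtain ⟨C₁, hC₁⟩ := h.sobolev 1
  set G : ℝ := ‖(curlCLM : (EuclideanSpace ℝ (Fin 3) →L[ℝ] EuclideanSpace ℝ (Fin 3)) →L[ℝ]
      EuclideanSpace ℝ (Fin 3))‖ ^ 2 * (C₁ : ℝ) + 2 * VectorCalculus.kineticEnergy u₀ with hGdef
  have hFap : ∀ s ∈ Icc 0 T, |F s| ≤ G := by
    intro s hs
    have h1 := abs_transport_le_apriori h hT hν h0 h0' hs
    obtain ⟨-, hω⟩ := integrable_norm_curl_sq ((h.classical.contDiff_velocity hs).of_le (by norm_cast))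
      ((h.slice hs).2.2 1)
    have hω' : ∫ x, ‖curl (u s) x‖ ^ 2 ≤ ‖(curlCLM : (EuclideanSpace ℝ (Fin 3) →L[ℝ]
        EuclideanSpace ℝ (Fin 3)) →L[ℝ] EuclideanSpace ℝ (Fin 3))‖ ^ 2 * (C₁ : ℝ) := by
      refine hω.trans (mul_le_mul_of_nonneg_left ?_ (sq_nonneg _))
      have := ENNReal.toReal_mono ENNReal.coe_ne_top (hC₁ s hs)
      simpa using this
    have hu' : ∫ x, ‖u s x‖ ^ 2 ≤ 2 * VectorCalculus.kineticEnergy u₀ := by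
      have hle := h.lintegral_enorm_sq_le hT hν.le hs
      have hKE : 0 ≤ 2 * VectorCalculus.kineticEnergy u₀ := by
        have := Literature.Analysis.FluidPDE.kineticEnergy_nonneg u₀; linarith
      have e : ∫ x, ‖u s x‖ ^ 2 = (∫⁻ x, ‖u s x‖ₑ ^ 2).toReal := by
        rw [integral_eq_lintegral_of_nonneg_ae (ae_of_all _ fun x => sq_nonneg _)
          ((h.classical.contDiff_velocity hs).continuous.norm.pow 2).aestronglyMeasurable]
        congr 1
        refine lintegral_congr fun x => ?_
        rw [← ofReal_norm, ENNReal.ofReal_pow (norm_nonneg _)]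
      rw [e]
      have := ENNReal.toReal_mono ENNReal.ofReal_ne_top hle
      rwa [ENNReal.toReal_ofReal hKE] at this
    exact h1.trans (add_le_add hω' hu')
  have hG0 : 0 ≤ G := (abs_nonneg _).trans (hFap 0 h0T)
  -- `|∫_{(0,s)} F| ≤ s G ≤ T G`
  have hIap : ∀ s ∈ Icc 0 T, |∫ r in Ioo 0 s, F r| ≤ T * G := by
    intro s hs
    calc |∫ r in Ioo 0 s, F r| ≤ ∫ r in Ioo 0 s, |F r| := by
          have := norm_integral_le_integral_norm (μ := volume.restrict (Ioo 0 s)) F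
          simpa only [Real.norm_eq_abs] using this
      _ ≤ ∫ r in Ioo 0 s, G := by
          refine integral_mono_of_nonneg (ae_of_all _ fun r => abs_nonneg _) (integrableOn_const
            (measure_Ioo_lt_top.ne) |>.integrable) ?_
          exact (ae_restrict_iff' measurableSet_Ioo).2 (ae_of_all _ fun r hr =>
            hFap r ⟨hr.1.le, hr.2.le.trans hs.2⟩)
      _ = s * G := by rw [setIntegral_const, Real.volume_real_Ioo_of_le hs.1, sub_zero, smul_eq_mul]
      _ ≤ T * G := mul_le_mul_of_nonneg_right hs.2 hG0
  -- the real moments and their sum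
  set Q : ℝ → ℝ := fun s => (Yp s + Yn s).toReal with hQdef
  have hQbound : ∀ s ∈ Icc 0 T, Yp s + Yn s ≤ ENNReal.ofReal (2 * P + 2 * (T * G)) := by
    intro s hs
    have hPG : 0 ≤ P + T * G := by positivity
    rcases hs.1.eq_or_lt with h0s | h0s
    · have e1 : Yp s ≤ ENNReal.ofReal P := by rw [← h0s, hYpdef]; simp only; rw [h.initial]; exact hPp
      have e2 : Yn s ≤ ENNReal.ofReal P := by rw [← h0s, hYndef]; simp only; rw [h.initial]; exact hPn
      calc Yp s + Yn s ≤ ENNReal.ofReal P + ENNReal.ofReal P := add_le_add e1 e2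
        _ = ENNReal.ofReal (P + P) := (ENNReal.ofReal_add hP.le hP.le).symm
        _ ≤ ENNReal.ofReal (2 * P + 2 * (T * G)) := ENNReal.ofReal_le_ofReal (by nlinarith)
    · have hs' : s ∈ Ioc 0 T := ⟨h0s, hs.2⟩
      have b1 : ENNReal.ofReal (∫ r in Ioo 0 s, F r) ≤ ENNReal.ofReal (T * G) :=
        ENNReal.ofReal_le_ofReal ((le_abs_self _).trans (hIap s hs))
      have b2 : ENNReal.ofReal (∫ r in Ioo 0 s, Fp r) ≤ ENNReal.ofReal (T * G) := by
        rw [setIntegral_congr_fun measurableSet_Ioo (fun r hr => hFeq r ⟨hr.1.le, hr.2.le.trans hs.2⟩)]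
        exact b1
      calc Yp s + Yn s ≤ (ENNReal.ofReal P + ENNReal.ofReal (T * G)) +
            (ENNReal.ofReal P + ENNReal.ofReal (T * G)) :=
            add_le_add ((hfluxp s hs').trans (add_le_add le_rfl b2))
              ((hfluxn s hs').trans (add_le_add le_rfl b1))
        _ = ENNReal.ofReal (2 * P + 2 * (T * G)) := by
            rw [← ENNReal.ofReal_add hP.le (by positivity), ← ENNReal.ofReal_add hPG hPG]
            congr 1; ring
  -- (4) the sup over `[0, τ]`
  set S : ℝ := sSup (Q '' Icc 0 τ) with hSdef
  have hbdd : BddAbove (Q '' Icc 0 τ) := by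
    refine ⟨2 * P + 2 * (T * G), ?_⟩
    rintro _ ⟨s, hs, rfl⟩
    have := ENNReal.toReal_mono ENNReal.ofReal_ne_top (hQbound s (hτT hs))
    rwa [ENNReal.toReal_ofReal (by positivity)] at this
  have hne : (Q '' Icc 0 τ).Nonempty := ⟨Q 0, ⟨0, ⟨le_rfl, hτ.1.le⟩, rfl⟩⟩
  have hQS : ∀ s ∈ Icc 0 τ, Q s ≤ S := fun s hs => le_csSup hbdd ⟨s, hs, rfl⟩
  have hS0 : 0 ≤ S := (ENNReal.toReal_nonneg).trans (hQS 0 ⟨le_rfl, hτ.1.le⟩)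
  -- (5) the slice bound `|F r| ≤ K √(√S) √S` for `r ∈ [0, τ]`
  have hslice : ∀ r ∈ Icc 0 τ, |F r| ≤ K * (Real.sqrt (Real.sqrt S) * Real.sqrt S) := by
    intro r hr
    have hrT := hτT hr
    have hfp := hfinp r hrT
    have hfn := hfinn r hrT
    obtain ⟨hΩi, hp', hn', hrp, hrn, -, hrabs, -⟩ := integrable_rsq_parts h hT hν h0 h0' hL1 hrT hfp hfn
    have h1 := transport_pairing_le h hT hν h0 h0' hL1 hM hrT hfp hfn
    -- `∫|Ω r| ≤ m`
    have hA : ∫ x, |angVortQuot (u r) x| ≤ m := by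
      have hle := (h.integrable_angVortQuot_of_datum hT hν h0 h0' hL1 hrT).2
      have e1 : ∫ x, |angVortQuot (u r) x| = (∫⁻ x, ‖angVortQuot (u r) x‖ₑ).toReal := by
        rw [← integral_norm_eq_lintegral_enorm hΩi.1]; simp only [Real.norm_eq_abs]
      have e2 : ∫ x, |angVortQuot u₀ x| = (∫⁻ x, ‖angVortQuot u₀ x‖ₑ).toReal := by
        rw [← integral_norm_eq_lintegral_enorm hL1.1]; simp only [Real.norm_eq_abs]
      rw [e1]
      refine le_trans (ENNReal.toReal_mono hL1.2.ne hle) ?_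
      rw [← e2]; exact hm
    -- `∫ (Ω r)⁻ ≤ m⁻`
    have hN : ∫ x, (angVortQuot (u r) x)⁻ ≤ mneg := by
      have hle : ∫⁻ x, ENNReal.ofReal ((angVortQuot (u r) x)⁻) ≤ ∫⁻ x, ENNReal.ofReal ((angVortQuot u₀ x)⁻) := by
        have := h.lintegral_negPart_angVortQuot_le hT hν.le hax hsw h0T hrT hrT.1
        rwa [h.initial] at this
      rw [integral_eq_lintegral_of_nonneg_ae (ae_of_all _ fun x => negPart_nonneg _) hn'.1]
      have := ENNReal.toReal_mono ENNReal.ofReal_ne_top (hle.trans hmneg)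
      rwa [ENNReal.toReal_ofReal hmneg0] at this
    -- `∫ r²|Ω r| = Q r ≤ S`, `∫ r²(Ω r)⁻ ≤ Q r ≤ S`
    have eYp : Yp r = ENNReal.ofReal (∫ x, cylRadius x ^ 2 * (angVortQuot (u r) x)⁺) := by
      rw [hYpdef]; simp only
      rw [ofReal_integral_eq_lintegral_ofReal hrp (ae_of_all _ fun x =>
        mul_nonneg (sq_nonneg _) (posPart_nonneg _))]
    have eYn : Yn r = ENNReal.ofReal (∫ x, cylRadius x ^ 2 * (angVortQuot (u r) x)⁻) := by
      rw [hYndef]; simp only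
      rw [ofReal_integral_eq_lintegral_ofReal hrn (ae_of_all _ fun x =>
        mul_nonneg (sq_nonneg _) (negPart_nonneg _))]
    have hYp0 : 0 ≤ ∫ x, cylRadius x ^ 2 * (angVortQuot (u r) x)⁺ :=
      integral_nonneg fun x => mul_nonneg (sq_nonneg _) (posPart_nonneg _)
    have hYn0 : 0 ≤ ∫ x, cylRadius x ^ 2 * (angVortQuot (u r) x)⁻ :=
      integral_nonneg fun x => mul_nonneg (sq_nonneg _) (negPart_nonneg _)
    have eQ : Q r = (∫ x, cylRadius x ^ 2 * (angVortQuot (u r) x)⁺) +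
        ∫ x, cylRadius x ^ 2 * (angVortQuot (u r) x)⁻ := by
      rw [hQdef]; simp only
      rw [eYp, eYn, ← ENNReal.ofReal_add hYp0 hYn0, ENNReal.toReal_ofReal (add_nonneg hYp0 hYn0)]
    have eabs : ∫ x, cylRadius x ^ 2 * |angVortQuot (u r) x| = Q r := by
      rw [eQ, ← integral_add hrp hrn]
      refine integral_congr_ae (ae_of_all _ fun x => ?_)
      show cylRadius x ^ 2 * |angVortQuot (u r) x| =
        cylRadius x ^ 2 * (angVortQuot (u r) x)⁺ + cylRadius x ^ 2 * (angVortQuot (u r) x)⁻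
      rw [← mul_add, posPart_add_negPart]
    have hYq : ∫ x, cylRadius x ^ 2 * |angVortQuot (u r) x| ≤ S := by rw [eabs]; exact hQS r hr
    have hYnS : ∫ x, cylRadius x ^ 2 * (angVortQuot (u r) x)⁻ ≤ S :=
      le_trans (by rw [eQ]; linarith) (hQS r hr)
    -- monotonicity of the square roots
    refine h1.trans ?_
    rw [hKdef]
    have s1 : Real.sqrt (M * (Real.sqrt (∫ x, |angVortQuot (u r) x|) *
        Real.sqrt (∫ x, cylRadius x ^ 2 * |angVortQuot (u r) x|))) ≤
        Real.sqrt (M * Real.sqrt m) * Real.sqrt (Real.sqrt S) := by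
      have e : Real.sqrt (M * Real.sqrt m) * Real.sqrt (Real.sqrt S) =
          Real.sqrt (M * Real.sqrt m * Real.sqrt S) := (Real.sqrt_mul (by positivity) _).symm
      rw [e]
      refine Real.sqrt_le_sqrt ?_
      rw [mul_assoc]
      refine mul_le_mul_of_nonneg_left ?_ hM0
      exact mul_le_mul (Real.sqrt_le_sqrt hA) (Real.sqrt_le_sqrt hYq) (Real.sqrt_nonneg _)
        (Real.sqrt_nonneg _)
    have s2 : Real.sqrt (∫ x, (angVortQuot (u r) x)⁻) *
        Real.sqrt (∫ x, cylRadius x ^ 2 * (angVortQuot (u r) x)⁻) ≤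
        Real.sqrt mneg * Real.sqrt S :=
      mul_le_mul (Real.sqrt_le_sqrt hN) (Real.sqrt_le_sqrt hYnS) (Real.sqrt_nonneg _)
        (Real.sqrt_nonneg _)
    calc 6 * Real.sqrt (M * (Real.sqrt (∫ x, |angVortQuot (u r) x|) *
          Real.sqrt (∫ x, cylRadius x ^ 2 * |angVortQuot (u r) x|))) *
          (Real.sqrt (∫ x, (angVortQuot (u r) x)⁻) *
            Real.sqrt (∫ x, cylRadius x ^ 2 * (angVortQuot (u r) x)⁻))
        ≤ 6 * (Real.sqrt (M * Real.sqrt m) * Real.sqrt (Real.sqrt S)) * (Real.sqrt mneg * Real.sqrt S) := by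
          gcongr
      _ = 6 * Real.sqrt (M * Real.sqrt m) * Real.sqrt mneg * (Real.sqrt (Real.sqrt S) * Real.sqrt S) := by
          ring
  -- (6) `Q s ≤ 2P + 2τK √(√S)√S` on `[0, τ]`, hence `S ≤ …`, hence `S ≤ 4P`
  have hI : ∀ s ∈ Icc 0 τ, |∫ r in Ioo 0 s, F r| ≤ τ * (K * (Real.sqrt (Real.sqrt S) * Real.sqrt S)) := by
    intro s hs
    have hc0 : 0 ≤ K * (Real.sqrt (Real.sqrt S) * Real.sqrt S) := by positivity
    calc |∫ r in Ioo 0 s, F r| ≤ ∫ r in Ioo 0 s, |F r| := by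
          have := norm_integral_le_integral_norm (μ := volume.restrict (Ioo 0 s)) F
          simpa only [Real.norm_eq_abs] using this
      _ ≤ ∫ r in Ioo 0 s, K * (Real.sqrt (Real.sqrt S) * Real.sqrt S) := by
          refine integral_mono_of_nonneg (ae_of_all _ fun r => abs_nonneg _) (integrableOn_const
            (measure_Ioo_lt_top.ne) |>.integrable) ?_
          exact (ae_restrict_iff' measurableSet_Ioo).2 (ae_of_all _ fun r hr =>
            hslice r ⟨hr.1.le, hr.2.le.trans hs.2⟩)
      _ = s * (K * (Real.sqrt (Real.sqrt S) * Real.sqrt S)) := by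
          rw [setIntegral_const, Real.volume_real_Ioo_of_le hs.1, sub_zero, smul_eq_mul]
      _ ≤ τ * (K * (Real.sqrt (Real.sqrt S) * Real.sqrt S)) := mul_le_mul_of_nonneg_right hs.2 hc0
  have hQle : ∀ s ∈ Icc 0 τ, Q s ≤ 2 * P + (2 * τ * K) * (Real.sqrt (Real.sqrt S) * Real.sqrt S) := by
    intro s hs
    have hc0 : 0 ≤ τ * (K * (Real.sqrt (Real.sqrt S) * Real.sqrt S)) := by
      have := hτ.1; positivity
    have hsum : Yp s + Yn s ≤ ENNReal.ofReal (2 * P + (2 * τ * K) * (Real.sqrt (Real.sqrt S) * Real.sqrt S)) := by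
      rcases hs.1.eq_or_lt with h0s | h0s
      · have e1 : Yp s ≤ ENNReal.ofReal P := by rw [← h0s, hYpdef]; simp only; rw [h.initial]; exact hPp
        have e2 : Yn s ≤ ENNReal.ofReal P := by rw [← h0s, hYndef]; simp only; rw [h.initial]; exact hPn
        calc Yp s + Yn s ≤ ENNReal.ofReal P + ENNReal.ofReal P := add_le_add e1 e2
          _ = ENNReal.ofReal (P + P) := (ENNReal.ofReal_add hP.le hP.le).symm
          _ ≤ _ := ENNReal.ofReal_le_ofReal (by nlinarith)
      · have hs' : s ∈ Ioc 0 T := ⟨h0s, hs.2.trans hτ.2⟩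
        have b1 : ENNReal.ofReal (∫ r in Ioo 0 s, F r) ≤
            ENNReal.ofReal (τ * (K * (Real.sqrt (Real.sqrt S) * Real.sqrt S))) :=
          ENNReal.ofReal_le_ofReal ((le_abs_self _).trans (hI s hs))
        have b2 : ENNReal.ofReal (∫ r in Ioo 0 s, Fp r) ≤
            ENNReal.ofReal (τ * (K * (Real.sqrt (Real.sqrt S) * Real.sqrt S))) := by
          rw [setIntegral_congr_fun measurableSet_Ioo (fun r hr =>
            hFeq r ⟨hr.1.le, hr.2.le.trans (hs.2.trans hτ.2)⟩)]
          exact b1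
        calc Yp s + Yn s ≤ (ENNReal.ofReal P + ENNReal.ofReal (τ * (K * (Real.sqrt (Real.sqrt S) *
              Real.sqrt S)))) + (ENNReal.ofReal P + ENNReal.ofReal (τ * (K * (Real.sqrt (Real.sqrt S) *
              Real.sqrt S)))) :=
              add_le_add ((hfluxp s hs').trans (add_le_add le_rfl b2))
                ((hfluxn s hs').trans (add_le_add le_rfl b1))
          _ = _ := by
              rw [← ENNReal.ofReal_add hP.le hc0, ← ENNReal.ofReal_add (by positivity) (by positivity)]
              congr 1; ring
    have := ENNReal.toReal_mono ENNReal.ofReal_ne_top hsum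
    rwa [ENNReal.toReal_ofReal (by have := hτ.1; positivity)] at this
  have hSle : S ≤ 2 * P + (2 * τ * K) * (Real.sqrt (Real.sqrt S) * Real.sqrt S) := by
    refine csSup_le hne ?_
    rintro _ ⟨s, hs, rfl⟩
    exact hQle s hs
  have hS4 : S ≤ 2 * (2 * P) :=
    scalar_bootstrap_sqrt hS0 (by positivity) (by rw [hKdef] at hsmall ⊢; linarith [hsmall]) hSle
  -- conclusion at `t`
  have hfin : Yp t + Yn t ≠ ⊤ := ENNReal.add_ne_top.2 ⟨(hfinp t (hτT ht)).ne, (hfinn t (hτT ht)).ne⟩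
  have hQt : Q t ≤ 4 * P := (hQS t ht).trans (by linarith)
  calc Yp t + Yn t = ENNReal.ofReal (Q t) := (ENNReal.ofReal_toReal hfin).symm
    _ ≤ ENNReal.ofReal (4 * P) := ENNReal.ofReal_le_ofReal hQt

end Impulse

/--
info: 'Summit.NavierStokesRegularity.NavierStokesRegularity.Theorems.L3TimeExponentPincerRingPersistenceImpulse.absImpulse_le' depends on axioms: [propext,
 Classical.choice,
 Quot.sound]
-/
#guard_msgs in
#print axioms absImpulse_le

end Summit.NavierStokesRegularity.NavierStokesRegularity.Theorems.L3TimeExponentPincerRingPersistenceImpulse
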